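import Summits.QuantumFields.BalabanUV.Beta.GAN24.BornBorderLetters
import Summits.QuantumFields.BalabanUV.Beta.GAN24.LegCompAssoc
import Summits.QuantumFields.BalabanUV.Beta.GAN24.MultiplierLegWard

/-!
# `BalabanUV.Beta.GAN24.BornBorderContactNest` — binder row G-an2-4 / (CONV-C), CT-ROUTE, (C4)-V module (C1): **THE NESTED V LINEAGES** — the dressed lineage
# `D_{i,k} = transport unitStepMap (i+1) (k−1−i) X_i` and the undressed one `U_{i,k}` as TWO three-slot pushes each, and the contact term `D_{i,k} − U_{i,k}` of ONE
# lineage as `−w^{k−i} •` the sum of the two channel differences with a COMMON multiplier leg (the (V-C) summand of leaf-01 g60's `BornBorderLetters` §3, nested)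

NOT IN PRINT; OUR BOOKKEEPING (G-an2-4 formalisation swarm → CRUX TEAM (2), leaf prover `b2b-balaban-gan24-formalise-leaf-03`, gen 55; (C4)-V typist of record per the OWNER's
W17, journal `CLAIMS.log` l.34977).  [folklore] algebra over leaf-01 g60's `BornBorderLetters` ((V-1): `dressed_v_succ`, `unitStepMap_v_sub_undressed`, `dressed_v_top`,
`undressed_v_top`) and g59's `BornBorderLineage.unitStepMap_v_eq_two_push₃`, leaf-01's `Push3Nest.push₃_push₃` and `Push3.push₃_smul ∕ push₃_neg ∕ push₃_add`, leaf-12's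
`RespStepSemigroup.legComp_respStep ∕ legComp_neg_left`, this seat's `LegCompAssoc.legComp_respStepBm_legChain` (the dressed composite IS the chain) and `MultiplierLegWard`
((C4)-V (A): NO multiplier-slot cell — `legComp (colM K̃_i Lc) T′ = legComp (colM K̃_i Lc) B′`, the same on `rowMM`, `d = 3`, `2 ≤ Lc`) BY NAME.  §1–§3 generic `d`; §4 at `d = 3`.
0 `def`, 0 cited facts, 0 `def … : Prop`, 0 sorry; NO estimate of Bałaban's — identities only.  HONEST FRAMING (cell contract, verbatim): «discharging `BetaPertH` makes
Bałaban's UV stability UNCONDITIONAL — a real milestone — but is NOT existence of continuum YM on T⁴ and NOT the Clay problem.»  This file discharges nothing: NOT (C4)-V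
closed (the weighted bound (C2) `BornBorderContactLineage` and the END (D) `BornBorderContactBound` follow), NOT hB of the V half, NEVER «G-an2-4 closed», NOT (CONV-C), NOT D1,
NOT `BetaPertH`.  HONEST DEPENDENCY: continuum YM on T⁴ ⇐ BetaPertH ∧ nine spine estimates (0/9 proved); BetaPertH ⇐ (D1) ∧ (D4) ∧ CAP+tail; G-an2-4 gates asym, D1 and NE2/3/4.

WHAT IS PROVED.  Notation (in-block root `ρ = toSite rr`, `rr ∈ box (d+1) Lc`): `V := cVH • vhSAt ρ`, `S := reslot inl inr V`, `S′ := reslot inr inl V`, `w := cE·Lc^{2(d+1)}`,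
`R_i := respStepBm ρ Lc (Lc^i) (Lc^(i+1))` (ONE dressed step), `R⁰_i := respStep (Lc^i) (Lc^(i+1))`, `K̃_i := KStepUnit Lc i`, `T′ := legChain (respStepBmSeq ρ Lc) (i+1) m`
(the dressed chain ABOVE the birth level), `B′ := respStep (Lc^(i+1)) (Lc^(i+(m+1)+1))`, `T_i := legChain (respStepBmSeq ρ Lc) i (m+1)`, `B_i := respStep (Lc^i) (Lc^(i+(m+1)+1))`.
* §1 `legDecay_neg`; `legChain_respStep_eq` — the chain of UNDRESSED one-steps is the multi-step response `respStep (Lc^i) (Lc^(i+n+1))` (leaf-12's semigroup law);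
  `exists_legDecay_respStep_multi` — hence the multi-step response is localised at the relative blocking `Lc^(n+1)` (leaf-01's `legDecay_legChain`).
* §2 `push₃_legChain_unitStepMap_v` — **THE DRESSED LINEAGE NESTS**: `push₃ T′ T′ T′ X_i = w • (−(push₃ (−T_i) (legComp (colM K̃_i Lc) T′) T_i S + push₃ (legComp (rowMM K̃_i Lc) T′) T_i T_i S′))`
  (linearity of the push on the class of local stencil families, `push₃_push₃`, and `legComp R_i T′ = T_i`).
* §3 `push₃_respStep_undressed_v` — **THE UNDRESSED LINEAGE NESTS**: `push₃ B′ B′ B′ Y⁰_i = −(push₃ (−B_i) (legComp (colM K̃_i Lc) B′) B_i S + push₃ (legComp (rowMM K̃_i Lc) B′) B_i B_i S′)`.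
* §4 (`d = 3`, `2 ≤ Lc`) `contact_v_eq_of_succ` — **THE CONTACT TERM OF ONE NESTED LINEAGE** (`k = i+(m+1)+1`): with the COMMON multiplier legs `M_i := legComp (colM K̃_i Lc) B′`,
  `M′_i := legComp (rowMM K̃_i Lc) B′` ((A): the dressed ones agree with them),
  `D_{i,k} − U_{i,k} = −(w^{m+1+1} • ((push₃ (−T_i) M_i T_i S − push₃ (−B_i) M_i B_i S) + (push₃ M′_i T_i T_i S′ − push₃ M′_i B_i B_i S′)))` — written against the LITERAL shape of the
  `hCg` binder of leaf-01's `BornBorderLetters.exists_hCv_of_polyGeometric` (`transport … (i+1) (k−1−i)`, `w^(k−i)`, `respStep (Lc^(i+1)) (Lc^k)`, a free `k` with `k = i+(m+1)+1`),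
  the RHS in the shape of (C2) `BornBorderContactLineage.abs_weight_mul_contact_v_le_three` at `n = m+1`;
  `contact_v_eq_of_top` — the top lineage (`k = i+0+1`) is leaf-01's one-step telescope `unitStepMap_v_sub_undressed`, LHS in the same literal shape, RHS in (C2)'s shape at `n = 0`.
-/

open Finset
open scoped BigOperators
open Literature.MathematicalPhysics.QuantumFieldTheory
open Literature.MathematicalPhysics.QuantumFieldTheory.Balaban1983to89
open Literature.MathematicalPhysics.QuantumFieldTheory.Balaban1983to89.Beta
open ExpKernelCalculus (MKer Decays)
open AffineAveraging (box toSite)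
open OneStepResolventKernel (Fib LocStencil)
open StepJetData (locStencil_smul)
open AveragingHessianKernelsRooted (vhSAt locStencil_vhSAt)
open BalabanCompositeJets (respStep)
open Summit.QuantumFields.BalabanUV.Beta.AxialDressingRooted (one_le_of_neZero)
open Summit.QuantumFields.BalabanUV.Beta.GAN24.CombesThomas (KStepUnit)
open Summit.QuantumFields.BalabanUV.Beta.GAN24.Push4 (IsFF legComp)
open Summit.QuantumFields.BalabanUV.Beta.GAN24.Push4Bounds (LegDecay)
open Summit.QuantumFields.BalabanUV.Beta.GAN24.Push4Iter (LegFam legChain legChain_zero legChain_succ legDecay_legChain)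
open Summit.QuantumFields.BalabanUV.Beta.GAN24.Push3 (push₃ push₃_smul push₃_neg push₃_add locStencil_push₃_mono)
open Summit.QuantumFields.BalabanUV.Beta.GAN24.Push3Nest (push₃_push₃)
open Summit.QuantumFields.BalabanUV.Beta.GAN24.AffineUnroll (transport)
open Summit.QuantumFields.BalabanUV.Beta.GAN24.RespStepSemigroup (legComp_respStep legComp_neg_left)
open Summit.QuantumFields.BalabanUV.Beta.GAN24.RespStepBm (respStepBm legDecay_respStepBm_of_decays legDecay_neg_respStepBm_of_decays)
open Summit.QuantumFields.BalabanUV.Beta.GAN24.RespStepBmDecompPsi (legDecay_respStep_of_decays decays_KStepUnit_levels legDecay_respStep_levels_holds)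
open Summit.QuantumFields.BalabanUV.Beta.GAN24.RespStepBmDecompExact (respStepBmSeq respStepBmSeq_apply)
open Summit.QuantumFields.BalabanUV.Beta.GAN24.SrecLinearPartEq (colM rowMM reslot legDecay_colM legDecay_rowMM locStencil_reslot)
open Summit.QuantumFields.BalabanUV.Beta.GAN24.SrecWilsonSector (legDecay_respStepBmSeq)
open Summit.QuantumFields.BalabanUV.Beta.GAN24.SrecBornSector (unitStepMap)
open Summit.QuantumFields.BalabanUV.Beta.GAN24.BornBorderLineage (unitStepMap_v_eq_two_push₃)
open Summit.QuantumFields.BalabanUV.Beta.GAN24.BornBorderLetters (dressed_v_succ dressed_v_top undressed_v_top unitStepMap_v_sub_undressed)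
open Summit.QuantumFields.BalabanUV.Beta.GAN24.LegCompAssoc (legComp_respStepBm_legChain)
open Summit.QuantumFields.BalabanUV.Beta.GAN24.MultiplierLegWard (legComp_colM_legChain_eq_respStep_three legComp_rowMM_legChain_eq_respStep_three)

namespace Summit.QuantumFields.BalabanUV.Beta.GAN24.BornBorderContactNest

variable {d : ℕ}

/-! ## §1 Negated legs; the chain of undressed one-steps is the multi-step response -/

/-- [folklore] A negated leg family has the same localisation. -/
theorem legDecay_neg {l : LegFam d} {N : ℕ} {C m : ℝ} (h : LegDecay l N C m) : LegDecay (-l) N C m := fun μ y κ u => by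
  simp only [Pi.neg_apply, abs_neg]
  exact h μ y κ u

section Levels

variable {Lc : ℕ} [NeZero Lc]

/-- [folklore] **THE CHAIN OF UNDRESSED ONE-STEP RESPONSES IS THE MULTI-STEP RESPONSE**: `legChain (j ↦ respStep (Lc^j) (Lc^(j+1))) i n = respStep (Lc^i) (Lc^(i+n+1))`
(leaf-12's `legComp_respStep`, induction on `n`). -/
theorem legChain_respStep_eq (i : ℕ) :
    ∀ n, legChain (fun j => respStep (d := d) (Lc ^ j) (Lc ^ (j + 1))) i n = respStep (d := d) (Lc ^ i) (Lc ^ (i + n + 1))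
  | 0 => by rw [legChain_zero]
  | n + 1 => by
    rw [legChain_succ, legChain_respStep_eq i n]
    exact legComp_respStep (L' := Lc) (pow_succ Lc (i + n + 1))

/-- [folklore] Hence the multi-step response `respStep (Lc^i) (Lc^(i+n+1))` is localised at the relative blocking `Lc^(n+1)` (leaf-01's `legDecay_legChain` on the levelwise
localisation `RespStepBmDecompPsi.legDecay_respStep_levels_holds`). -/
theorem exists_legDecay_respStep_multi (i n : ℕ) :
    ∃ C m : ℝ, 0 < m ∧ LegDecay (respStep (d := d) (Lc ^ i) (Lc ^ (i + n + 1))) (Lc ^ (n + 1)) C m := by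
  obtain ⟨C, m, hm, h⟩ := legDecay_legChain (legDecay_respStep_levels_holds (d := d) (Lc := Lc)) i n
  exact ⟨C, m, hm, by rwa [legChain_respStep_eq] at h⟩

end Levels

/-! ## §2 The dressed lineage nests -/

section Nest

variable {Lc : ℕ} [NeZero Lc]

/-- NOT IN PRINT; OUR BOOKKEEPING ([folklore]; generic `d`, in-block root).  **THE DRESSED V LINEAGE NESTS INTO TWO THREE-SLOT PUSHES**: with `T′ = legChain (respStepBmSeq ρ Lc) (i+1) m`,
`T_i = legChain (respStepBmSeq ρ Lc) i (m+1)`,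
`push₃ T′ T′ T′ X_i = w • (−(push₃ (−T_i) (legComp (colM K̃_i Lc) T′) T_i (reslot inl inr V) + push₃ (legComp (rowMM K̃_i Lc) T′) T_i T_i (reslot inr inl V)))`
— `X_i` is `w •` minus the two mixed-channel pushes (`unitStepMap_v_eq_two_push₃`), the push is linear on the class of local stencil families (`push₃_smul ∕ push₃_neg ∕ push₃_add`),
the pushes nest (`push₃_push₃`), and the field-slot composite `legComp R_i T′` IS the chain `T_i` (`LegCompAssoc.legComp_respStepBm_legChain`). -/
theorem push₃_legChain_unitStepMap_v {rr : Fin (d + 1) → ℕ} (hrr : rr ∈ box (d + 1) Lc) (cE cVH : ℝ) (i m : ℕ) (κ' : Fin (d + 1)) (u' : Fin (d + 1) → ℤ) :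
    push₃ (legChain (respStepBmSeq (d := d) (toSite rr) Lc) (i + 1) m) (legChain (respStepBmSeq (d := d) (toSite rr) Lc) (i + 1) m)
        (legChain (respStepBmSeq (d := d) (toSite rr) Lc) (i + 1) m) (unitStepMap Lc (toSite rr) cE i (fun κ u => cVH • vhSAt (toSite rr) d Lc rfl κ u)) κ' u'
      = (cE * (Lc : ℝ) ^ (2 * (d + 1))) •
          -(push₃ (-legChain (respStepBmSeq (d := d) (toSite rr) Lc) i (m + 1))
                (legComp (colM (KStepUnit (d := d) Lc i) Lc) (legChain (respStepBmSeq (d := d) (toSite rr) Lc) (i + 1) m))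
                (legChain (respStepBmSeq (d := d) (toSite rr) Lc) i (m + 1)) (reslot Sum.inl Sum.inr fun κ u => cVH • vhSAt (toSite rr) d Lc rfl κ u) κ' u'
            + push₃ (legComp (rowMM (KStepUnit (d := d) Lc i) Lc) (legChain (respStepBmSeq (d := d) (toSite rr) Lc) (i + 1) m))
                (legChain (respStepBmSeq (d := d) (toSite rr) Lc) i (m + 1)) (legChain (respStepBmSeq (d := d) (toSite rr) Lc) i (m + 1))
                (reslot Sum.inr Sum.inl fun κ u => cVH • vhSAt (toSite rr) d Lc rfl κ u) κ' u') := by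
  have hLc : 1 ≤ Lc := one_le_of_neZero Lc
  obtain ⟨CK, mK, hmK, hK⟩ := decays_KStepUnit_levels (d := d) (Lc := Lc) i
  -- the inner legs, localised at blocking `Lc`
  have hl₂ := legDecay_neg_respStepBm_of_decays hLc hrr hK hmK.le
  have hw₂ := legDecay_respStepBm_of_decays hLc hrr hK hmK.le
  have hc₂ : LegDecay (colM (KStepUnit (d := d) Lc i) Lc) Lc CK mK := legDecay_colM hK
  have hm₂ : LegDecay (rowMM (KStepUnit (d := d) Lc i) Lc) Lc CK mK := legDecay_rowMM hK
  -- the outer legs: the chain above the birth level, localised at blocking `Lc^(m+1)`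
  obtain ⟨C₁, m₁, hm₁, hT⟩ := legDecay_legChain (N := Lc) (fun j => legDecay_respStepBmSeq (d := d) (Lc := Lc) hrr j) (i + 1) m
  -- the two channel tables and the two inner pushes are local stencil families
  have hδ : (0 : ℝ) < mK / 4 := by positivity
  have hV : LocStencil (fun κ u => cVH • vhSAt (toSite rr) d Lc rfl κ u) _ (mK / 4) := locStencil_smul cVH (locStencil_vhSAt hLc hrr hδ.le)
  have hS := locStencil_reslot hV Sum.inl Sum.inr
  have hS' := locStencil_reslot hV Sum.inr Sum.inl
  have hP₁ := locStencil_push₃_mono hLc hl₂ hc₂ hw₂ hS hδ.le (by linarith)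
  have hP₂ := locStencil_push₃_mono hLc hm₂ hw₂ hw₂ hS' hδ.le (by linarith)
  rw [unitStepMap_v_eq_two_push₃ hrr cE cVH i, push₃_smul, push₃_neg, push₃_add hT hT hT hm₁ hP₁ hP₂ hδ hδ,
    push₃_push₃ hT hT hT hl₂ hc₂ hw₂ hm₁ hmK hS hδ, push₃_push₃ hT hT hT hm₂ hw₂ hw₂ hm₁ hmK hS' hδ, legComp_neg_left,
    legComp_respStepBm_legChain hLc hrr i m]

/-! ## §3 The undressed lineage nests -/

/-- NOT IN PRINT; OUR BOOKKEEPING ([folklore]; generic `d`, in-block root).  **THE UNDRESSED V LINEAGE NESTS INTO TWO THREE-SLOT PUSHES**: with `B′ = respStep (Lc^(i+1)) (Lc^(i+(m+1)+1))`,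
`B_i = respStep (Lc^i) (Lc^(i+(m+1)+1))`,
`push₃ B′ B′ B′ Y⁰_i = −(push₃ (−B_i) (legComp (colM K̃_i Lc) B′) B_i (reslot inl inr V) + push₃ (legComp (rowMM K̃_i Lc) B′) B_i B_i (reslot inr inl V))`
(`push₃_neg ∕ push₃_add ∕ push₃_push₃`, §1 for the localisation of `B′`, and leaf-12's semigroup law `legComp R⁰_i B′ = B_i`). -/
theorem push₃_respStep_undressed_v {rr : Fin (d + 1) → ℕ} (hrr : rr ∈ box (d + 1) Lc) (cVH : ℝ) (i m : ℕ) (κ' : Fin (d + 1)) (u' : Fin (d + 1) → ℤ) :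
    push₃ (respStep (d := d) (Lc ^ (i + 1)) (Lc ^ (i + (m + 1) + 1))) (respStep (d := d) (Lc ^ (i + 1)) (Lc ^ (i + (m + 1) + 1)))
        (respStep (d := d) (Lc ^ (i + 1)) (Lc ^ (i + (m + 1) + 1)))
        (fun κ u => -(push₃ (-respStep (d := d) (Lc ^ i) (Lc ^ (i + 1))) (colM (KStepUnit (d := d) Lc i) Lc)
              (respStep (d := d) (Lc ^ i) (Lc ^ (i + 1))) (reslot Sum.inl Sum.inr fun κ u => cVH • vhSAt (toSite rr) d Lc rfl κ u) κ u
          + push₃ (rowMM (KStepUnit (d := d) Lc i) Lc) (respStep (d := d) (Lc ^ i) (Lc ^ (i + 1)))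
              (respStep (d := d) (Lc ^ i) (Lc ^ (i + 1))) (reslot Sum.inr Sum.inl fun κ u => cVH • vhSAt (toSite rr) d Lc rfl κ u) κ u)) κ' u'
      = -(push₃ (-respStep (d := d) (Lc ^ i) (Lc ^ (i + (m + 1) + 1)))
              (legComp (colM (KStepUnit (d := d) Lc i) Lc) (respStep (d := d) (Lc ^ (i + 1)) (Lc ^ (i + (m + 1) + 1))))
              (respStep (d := d) (Lc ^ i) (Lc ^ (i + (m + 1) + 1))) (reslot Sum.inl Sum.inr fun κ u => cVH • vhSAt (toSite rr) d Lc rfl κ u) κ' u'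
          + push₃ (legComp (rowMM (KStepUnit (d := d) Lc i) Lc) (respStep (d := d) (Lc ^ (i + 1)) (Lc ^ (i + (m + 1) + 1))))
              (respStep (d := d) (Lc ^ i) (Lc ^ (i + (m + 1) + 1))) (respStep (d := d) (Lc ^ i) (Lc ^ (i + (m + 1) + 1)))
              (reslot Sum.inr Sum.inl fun κ u => cVH • vhSAt (toSite rr) d Lc rfl κ u) κ' u') := by
  have hLc : 1 ≤ Lc := one_le_of_neZero Lc
  obtain ⟨CK, mK, hmK, hK⟩ := decays_KStepUnit_levels (d := d) (Lc := Lc) i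
  -- the inner legs, localised at blocking `Lc`
  have hw₂ : LegDecay (respStep (d := d) (Lc ^ i) (Lc ^ (i + 1))) Lc CK mK := legDecay_respStep_of_decays hK
  have hl₂ := legDecay_neg hw₂
  have hc₂ : LegDecay (colM (KStepUnit (d := d) Lc i) Lc) Lc CK mK := legDecay_colM hK
  have hm₂ : LegDecay (rowMM (KStepUnit (d := d) Lc i) Lc) Lc CK mK := legDecay_rowMM hK
  -- the outer legs: the multi-step response above the birth level, localised at blocking `Lc^(m+1)`
  obtain ⟨C₁, m₁, hm₁, hB⟩ := exists_legDecay_respStep_multi (d := d) (Lc := Lc) (i + 1) m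
  rw [show i + 1 + m + 1 = i + (m + 1) + 1 by omega] at hB
  have hδ : (0 : ℝ) < mK / 4 := by positivity
  have hV : LocStencil (fun κ u => cVH • vhSAt (toSite rr) d Lc rfl κ u) _ (mK / 4) := locStencil_smul cVH (locStencil_vhSAt hLc hrr hδ.le)
  have hS := locStencil_reslot hV Sum.inl Sum.inr
  have hS' := locStencil_reslot hV Sum.inr Sum.inl
  have hP₁ := locStencil_push₃_mono hLc hl₂ hc₂ hw₂ hS hδ.le (by linarith)
  have hP₂ := locStencil_push₃_mono hLc hm₂ hw₂ hw₂ hS' hδ.le (by linarith)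
  have hsg : legComp (respStep (d := d) (Lc ^ i) (Lc ^ (i + 1))) (respStep (d := d) (Lc ^ (i + 1)) (Lc ^ (i + (m + 1) + 1)))
      = respStep (d := d) (Lc ^ i) (Lc ^ (i + (m + 1) + 1)) :=
    legComp_respStep (L' := Lc ^ (m + 1)) (by ring)
  rw [push₃_neg, push₃_add hB hB hB hm₁ hP₁ hP₂ hδ hδ, push₃_push₃ hB hB hB hl₂ hc₂ hw₂ hm₁ hmK hS hδ,
    push₃_push₃ hB hB hB hm₂ hw₂ hw₂ hm₁ hmK hS' hδ, legComp_neg_left, hsg]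

end Nest

/-! ## §4 The contact term of one lineage (`d = 3`, `2 ≤ Lc`), in the literal shape of leaf-01's `hCg` binder -/

section Three

variable {Lc : ℕ} [NeZero Lc]

/-- NOT IN PRINT; OUR BOOKKEEPING ([folklore]; `d = 3`, `2 ≤ Lc`, in-block root).  **THE CONTACT TERM OF ONE NESTED V LINEAGE** (`k = i+(m+1)+1`, `m ≥ 0`): with the COMMON multiplier legs
`M_i = legComp (colM K̃_i Lc) B′`, `M′_i = legComp (rowMM K̃_i Lc) B′` (`B′ = respStep (Lc^(i+1)) (Lc^k)`; the dressed multiplier legs `legComp (colM∕rowMM K̃_i Lc) T′` AGREE with them —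
this seat's `MultiplierLegWard`, an1's multiplier-column Ward identities: the V contact has NO multiplier-slot cell),
`D_{i,k} − U_{i,k} = −(w^{m+1+1} • ((push₃ (−T_i) M_i T_i S − push₃ (−B_i) M_i B_i S) + (push₃ M′_i T_i T_i S′ − push₃ M′_i B_i B_i S′)))`,
`T_i = legChain (respStepBmSeq ρ Lc) i (m+1)` the LONG dressed chain from the birth level, `B_i = respStep (Lc^i) (Lc^k)` its undressed counterpart — two field-slot telescopes
`T_i − B_i` per channel remain (the cells of (B2) ∕ (B3)), nothing in the multiplier slot. -/
theorem contact_v_eq_of_succ (hLc : 2 ≤ Lc) {rr : Fin (3 + 1) → ℕ} (hrr : rr ∈ box (3 + 1) Lc) (cE cVH : ℝ) {i m k : ℕ} (hk : k = i + (m + 1) + 1)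
    (κ' : Fin (3 + 1)) (u' : Fin (3 + 1) → ℤ) :
    transport (unitStepMap Lc (toSite rr) cE) (i + 1) (k - 1 - i) (unitStepMap Lc (toSite rr) cE i (fun κ u => cVH • vhSAt (toSite rr) 3 Lc rfl κ u)) κ' u'
        - (cE * (Lc : ℝ) ^ (2 * (3 + 1))) ^ (k - i) •
            push₃ (respStep (d := 3) (Lc ^ (i + 1)) (Lc ^ k)) (respStep (d := 3) (Lc ^ (i + 1)) (Lc ^ k)) (respStep (d := 3) (Lc ^ (i + 1)) (Lc ^ k))
              (fun κ u => -(push₃ (-respStep (d := 3) (Lc ^ i) (Lc ^ (i + 1))) (colM (KStepUnit (d := 3) Lc i) Lc)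
                    (respStep (d := 3) (Lc ^ i) (Lc ^ (i + 1))) (reslot Sum.inl Sum.inr fun κ u => cVH • vhSAt (toSite rr) 3 Lc rfl κ u) κ u
                + push₃ (rowMM (KStepUnit (d := 3) Lc i) Lc) (respStep (d := 3) (Lc ^ i) (Lc ^ (i + 1)))
                    (respStep (d := 3) (Lc ^ i) (Lc ^ (i + 1))) (reslot Sum.inr Sum.inl fun κ u => cVH • vhSAt (toSite rr) 3 Lc rfl κ u) κ u)) κ' u'
      = -((cE * (Lc : ℝ) ^ (2 * (3 + 1))) ^ (m + 1 + 1) •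
          ((push₃ (-legChain (respStepBmSeq (d := 3) (toSite rr) Lc) i (m + 1))
                (legComp (colM (KStepUnit (d := 3) Lc i) Lc) (respStep (d := 3) (Lc ^ (i + 1)) (Lc ^ (i + (m + 1) + 1))))
                (legChain (respStepBmSeq (d := 3) (toSite rr) Lc) i (m + 1)) (reslot Sum.inl Sum.inr fun κ u => cVH • vhSAt (toSite rr) 3 Lc rfl κ u) κ' u'
              - push₃ (-respStep (d := 3) (Lc ^ i) (Lc ^ (i + (m + 1) + 1)))
                  (legComp (colM (KStepUnit (d := 3) Lc i) Lc) (respStep (d := 3) (Lc ^ (i + 1)) (Lc ^ (i + (m + 1) + 1))))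
                  (respStep (d := 3) (Lc ^ i) (Lc ^ (i + (m + 1) + 1))) (reslot Sum.inl Sum.inr fun κ u => cVH • vhSAt (toSite rr) 3 Lc rfl κ u) κ' u')
            + (push₃ (legComp (rowMM (KStepUnit (d := 3) Lc i) Lc) (respStep (d := 3) (Lc ^ (i + 1)) (Lc ^ (i + (m + 1) + 1))))
                  (legChain (respStepBmSeq (d := 3) (toSite rr) Lc) i (m + 1)) (legChain (respStepBmSeq (d := 3) (toSite rr) Lc) i (m + 1))
                  (reslot Sum.inr Sum.inl fun κ u => cVH • vhSAt (toSite rr) 3 Lc rfl κ u) κ' u'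
              - push₃ (legComp (rowMM (KStepUnit (d := 3) Lc i) Lc) (respStep (d := 3) (Lc ^ (i + 1)) (Lc ^ (i + (m + 1) + 1))))
                  (respStep (d := 3) (Lc ^ i) (Lc ^ (i + (m + 1) + 1))) (respStep (d := 3) (Lc ^ i) (Lc ^ (i + (m + 1) + 1)))
                  (reslot Sum.inr Sum.inl fun κ u => cVH • vhSAt (toSite rr) 3 Lc rfl κ u) κ' u'))) := by
  subst hk
  rw [show i + (m + 1) + 1 - 1 - i = m + 1 by omega, show i + (m + 1) + 1 - i = m + 1 + 1 by omega, dressed_v_succ hrr cE cVH i m]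
  dsimp only
  rw [push₃_legChain_unitStepMap_v hrr cE cVH i m κ' u', push₃_respStep_undressed_v hrr cVH i m κ' u',
    legComp_colM_legChain_eq_respStep_three hLc hrr i m, legComp_rowMM_legChain_eq_respStep_three hLc hrr i m,
    show i + 1 + m + 1 = i + (m + 1) + 1 by omega, smul_smul, ← pow_succ]
  simp only [smul_neg, smul_add, smul_sub]
  abel

/-- NOT IN PRINT; OUR BOOKKEEPING ([folklore]; `d = 3`).  **THE CONTACT TERM OF THE TOP LINEAGE** (`k = i+0+1`) is leaf-01's one-step telescope
`BornBorderLetters.unitStepMap_v_sub_undressed` (`dressed_v_top`, `undressed_v_top`), the LHS in the literal shape of the `hCg` binder, the RHS in the shape of the nested case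
at `n = 0` (`w^(0+1)`, `T_i = legChain (respStepBmSeq ρ Lc) i 0`, `B_i = respStep (Lc^i) (Lc^(i+0+1))`, multiplier legs `colM ∕ rowMM K̃_i Lc` uncomposed). -/
theorem contact_v_eq_of_top {rr : Fin (3 + 1) → ℕ} (hrr : rr ∈ box (3 + 1) Lc) (cE cVH : ℝ) {i k : ℕ} (hk : k = i + 0 + 1)
    (κ' : Fin (3 + 1)) (u' : Fin (3 + 1) → ℤ) :
    transport (unitStepMap Lc (toSite rr) cE) (i + 1) (k - 1 - i) (unitStepMap Lc (toSite rr) cE i (fun κ u => cVH • vhSAt (toSite rr) 3 Lc rfl κ u)) κ' u'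
        - (cE * (Lc : ℝ) ^ (2 * (3 + 1))) ^ (k - i) •
            push₃ (respStep (d := 3) (Lc ^ (i + 1)) (Lc ^ k)) (respStep (d := 3) (Lc ^ (i + 1)) (Lc ^ k)) (respStep (d := 3) (Lc ^ (i + 1)) (Lc ^ k))
              (fun κ u => -(push₃ (-respStep (d := 3) (Lc ^ i) (Lc ^ (i + 1))) (colM (KStepUnit (d := 3) Lc i) Lc)
                    (respStep (d := 3) (Lc ^ i) (Lc ^ (i + 1))) (reslot Sum.inl Sum.inr fun κ u => cVH • vhSAt (toSite rr) 3 Lc rfl κ u) κ u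
                + push₃ (rowMM (KStepUnit (d := 3) Lc i) Lc) (respStep (d := 3) (Lc ^ i) (Lc ^ (i + 1)))
                    (respStep (d := 3) (Lc ^ i) (Lc ^ (i + 1))) (reslot Sum.inr Sum.inl fun κ u => cVH • vhSAt (toSite rr) 3 Lc rfl κ u) κ u)) κ' u'
      = -((cE * (Lc : ℝ) ^ (2 * (3 + 1))) ^ (0 + 1) •
          ((push₃ (-legChain (respStepBmSeq (d := 3) (toSite rr) Lc) i 0) (colM (KStepUnit (d := 3) Lc i) Lc)
                (legChain (respStepBmSeq (d := 3) (toSite rr) Lc) i 0) (reslot Sum.inl Sum.inr fun κ u => cVH • vhSAt (toSite rr) 3 Lc rfl κ u) κ' u'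
              - push₃ (-respStep (d := 3) (Lc ^ i) (Lc ^ (i + 0 + 1))) (colM (KStepUnit (d := 3) Lc i) Lc)
                  (respStep (d := 3) (Lc ^ i) (Lc ^ (i + 0 + 1))) (reslot Sum.inl Sum.inr fun κ u => cVH • vhSAt (toSite rr) 3 Lc rfl κ u) κ' u')
            + (push₃ (rowMM (KStepUnit (d := 3) Lc i) Lc) (legChain (respStepBmSeq (d := 3) (toSite rr) Lc) i 0)
                  (legChain (respStepBmSeq (d := 3) (toSite rr) Lc) i 0) (reslot Sum.inr Sum.inl fun κ u => cVH • vhSAt (toSite rr) 3 Lc rfl κ u) κ' u'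
              - push₃ (rowMM (KStepUnit (d := 3) Lc i) Lc) (respStep (d := 3) (Lc ^ i) (Lc ^ (i + 0 + 1)))
                  (respStep (d := 3) (Lc ^ i) (Lc ^ (i + 0 + 1)))
                  (reslot Sum.inr Sum.inl fun κ u => cVH • vhSAt (toSite rr) 3 Lc rfl κ u) κ' u'))) := by
  subst hk
  simp only [Nat.add_zero, legChain_zero, respStepBmSeq_apply, zero_add, pow_one]
  rw [show i + 1 - 1 - i = 0 by omega, dressed_v_top, undressed_v_top, ← unitStepMap_v_sub_undressed hrr cE cVH i κ' u']

end Three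

end Summit.QuantumFields.BalabanUV.Beta.GAN24.BornBorderContactNest
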